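import Mathlib

/-! Scratch: sanity checks of the grid bookkeeping of line `alternating-curvature-arrays` (copies of the defs). -/

def cellMap (m : ℕ) (v z₀ z t : ℤ) : ℤ :=
  if Even (z - z₀) then t + 3 ^ m * (z - z₀) / 2 else 2 * v + 3 ^ m * (z + z₀ + 1) / 2 - t

def numCells (L m : ℕ) : ℕ := 2 * (2 * L + 1) / 3 ^ m

-- level m = 2: cell side 9/2; offset v = 0: walls at 0, 4.5, 9, 13.5, 18, -4.5 …; cell 0 = (0, 4.5) ∋ sites 1..4
example : (List.map (cellMap 2 0 0 1) [1, 2, 3, 4]) = [8, 7, 6, 5] := by decide      -- reflection into (4.5, 9)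
example : (List.map (cellMap 2 0 0 2) [1, 2, 3, 4]) = [10, 11, 12, 13] := by decide  -- translation into (9, 13.5)
example : (List.map (cellMap 2 0 0 3) [1, 2, 3, 4]) = [17, 16, 15, 14] := by decide  -- reflection into (13.5, 18)
example : (List.map (cellMap 2 0 0 (-1)) [1, 2, 3, 4]) = [-1, -2, -3, -4] := by decide  -- reflection in the site wall 0
-- offset v = 1: walls at 1, 5.5, 10; cell 0 = (1, 5.5) ∋ sites 2..5; cell 1 = (5.5, 10) ∋ 6..9
example : (List.map (cellMap 2 1 0 1) [2, 3, 4, 5]) = [9, 8, 7, 6] := by decide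
-- home cell z₀ = 1 (sites 5..8 for v = 0) to cell 2 = (9, 13.5): reflection in the wall 9
example : (List.map (cellMap 2 0 1 2) [5, 6, 7, 8]) = [13, 12, 11, 10] := by decide
-- home z₀ = 1 to z = 3: translation by 9
example : (List.map (cellMap 2 0 1 3) [5, 6, 7, 8]) = [14, 15, 16, 17] := by decide
-- torus 2L+1 = 27 (L = 13): admissible levels m = 0,1,2 with 54, 18, 6 cells; m = 3 not admissible
example : numCells 13 2 = 6 ∧ numCells 13 1 = 18 ∧ numCells 13 0 = 54 := by decide
example : (3 ^ (2 + 1) ∣ 2 * 13 + 1) ∧ ¬ (3 ^ (3 + 1) ∣ 2 * 13 + 1) := by decide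
-- periodicity: transport to z and to z + numCells agree mod the torus side 27 (m = 2, numCells = 6)
example : ∀ t ∈ [1, 2, 3, 4], (cellMap 2 0 0 7 t - cellMap 2 0 0 1 t) % 27 = 0 ∧
    (cellMap 2 0 0 6 t - cellMap 2 0 0 0 t) % 27 = 0 := by decide
-- the group law: z ↦ cellMap … z₀ z is a bijection cell z₀ → cell z and transports compose:
-- (z₀ → z₁) then (z₁ → z₂) equals (z₀ → z₂) on sample points
example : ∀ t ∈ [1, 2, 3, 4], cellMap 2 0 1 2 (cellMap 2 0 0 1 t) = cellMap 2 0 0 2 t ∧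
    cellMap 2 0 2 3 (cellMap 2 0 0 2 t) = cellMap 2 0 0 3 t ∧
    cellMap 2 0 1 3 (cellMap 2 0 0 1 t) = cellMap 2 0 0 3 t := by decide
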